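import Summits.Langlands.Langlands.Theses.SenNullAlignment
import Summits.Langlands.Langlands.Theorems.IrreducibilityBySelfDualityReciprocityUpToIrreducibilityCorrespondsConj

/-!
# Crux-attack certificate for `AlignedAtEll` (stmt-Langlands-16360): the crux is a FRAGMENT of the summit

Refuter probe "S → C" of the crux attack, kernel-checked: `Langlands → AlignedAtEll`.  The summit's
direction (A) for `n = 2` over `K` gives SOME `ρ₁` corresponding to `π` for the reciprocity datum `RD`;
the accepted weak-to-strong upgrade (`corresponds_of_exists_corresponds`: Chebotarev + Brauer–Nesbitt +
change of frame, file `IrreducibilityBySelfDualityReciprocityUpToIrreducibilityCorrespondsConj`) transfers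
`Corresponds` and `IsGeometricFramed` to EVERY `ρ` that is Satake–Frobenius compatible with `π` almost
everywhere (irreducibility transfers too, `IrreducibleOffSector.isIrreducible_of_satakeFrobCompatible`) —
in particular local–global compatibility and de Rham-ness at the place `v`.

HYPOTHESIS MUTATION (formal): `alignedAtEll_core_of_langlands` shows that, GIVEN the summit, the crux's
conclusion already follows from `π` L-algebraic + `ρ` Satake–Frobenius compatible a.e.; total reality,
`RD` serving the regular case, holomorphy of weight `(k, w)`, oddness, `∃ k_β = 1`, irreducibility of `ρ`,
alignment of `v` and projective finiteness of inertia are NOT needed for TRUTH — they serve PROVABILITY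
(they are the route's mechanism).  Consequence for the refuter: an unconditional `¬ AlignedAtEll` would be
a `¬ Langlands`; the crux cannot be "false for the wrong reason" through its `∀ RD` / `∀ ρ` quantifiers.
The converse `AlignedAtEll → Langlands` is not derivable (the crux speaks of one place of one `π` for
`GL₂` over a totally real field), so the crux does not restate the summit.
-/

set_option linter.dupNamespace false

open scoped Classical
open Summit.Langlands
open Summit.Langlands.Langlands.Theorems.ReciprocityUpToIrreducibility
open Literature.NumberTheory.Automorphic Literature.NumberTheory.GaloisRepresentations

namespace Summit.Langlands.Langlands.Cruxes.AlignedAtEll.RefuterProbe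

/-- **The load-bearing core, given the summit**: for EVERY number field `K`, EVERY reciprocity datum
`RD`, every L-algebraic cuspidal `π` on `GL₂(𝔸_K)`, every `ℓ, ι` and every `ρ` Satake–Frobenius
compatible with `π` at almost all places, `ρ` is irreducible, corresponds to `π` at EVERY finite place and
is de Rham at every `v ∣ ℓ` (weak-to-strong upgrade of direction (A) at `n = 2`). [folklore] -/
theorem core_of_langlands (hS : _root_.Langlands) (K : Type) [Field K] [NumberField K]
    (RD : ReciprocityData K) (hcpt : isCompact_glFiniteIntegralLevel 2 K)
    (π : CuspidalAutomorphicRepData 2 K hcpt) (hL : π.1.IsLAlgebraic) (ℓ : ℕ) [Fact ℓ.Prime]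
    (ι : PadicAlgCl ℓ ≃+* ℂ) (ρ : FramedGaloisRep K (PadicAlgCl ℓ) 2)
    (hae : ∀ᶠ v : IsDedekindDomain.HeightOneSpectrum (NumberField.RingOfIntegers K) in Filter.cofinite,
      SatakeFrobCompatibleAt ι π.1 ρ v) :
    ρ.toGaloisRep.IsIrreducible ∧ IsGeometricFramed RD ρ ∧ Corresponds RD ι π.1 ρ := by
  obtain ⟨-, hall⟩ := hS K
  obtain ⟨ρ₁, hirr₁, hgeo₁, hcorr₁, -⟩ := (hall RD 2 two_pos hcpt).1 π hL ℓ ι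
  have hirr : ρ.toGaloisRep.IsIrreducible :=
    Summit.Langlands.Langlands.Theorems.IrreducibleOffSector.isIrreducible_of_satakeFrobCompatible π.1 ι
      hirr₁ hcorr₁.1 hae
  have hconj : IsConjugate ρ₁ ρ := isConjugate_of_satakeFrobCompatibleAt π.1 ι hirr₁ hcorr₁.1 hae
  exact ⟨hirr, isGeometricFramed_of_isConjugate hgeo₁ hconj,
    corresponds_of_exists_corresponds hirr hae ⟨ρ₁, hcorr₁⟩⟩

/-- **The crux's conclusion with 8 of its hypotheses dropped, given the summit** (hypothesis mutation
made formal: no total reality, no `hreg`, no weight/holomorphy, no oddness, no `∃ k_β = 1`, no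
irreducibility, no alignment, no finiteness of inertia). [folklore] -/
theorem alignedAtEll_core_of_langlands (hS : _root_.Langlands) :
    ∀ (K : Type) [Field K] [NumberField K] (RD : ReciprocityData K)
      (hcpt : isCompact_glFiniteIntegralLevel 2 K) (π : CuspidalAutomorphicRepData 2 K hcpt),
      π.1.IsLAlgebraic → ∀ (ℓ : ℕ) [Fact ℓ.Prime] (ι : PadicAlgCl ℓ ≃+* ℂ)
      (ρ : FramedGaloisRep K (PadicAlgCl ℓ) 2),
      (∀ᶠ v : IsDedekindDomain.HeightOneSpectrum (NumberField.RingOfIntegers K) in Filter.cofinite,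
        SatakeFrobCompatibleAt ι π.1 ρ v) →
      ∀ (v : IsDedekindDomain.HeightOneSpectrum (NumberField.RingOfIntegers K))
        (hv : ((ℓ : ℕ) : NumberField.RingOfIntegers K) ∈ v.asIdeal),
        LocalGlobalCompatibleAt RD ι π.1 ρ v ∧ (RD.pst ℓ v hv).IsDeRhamFramed (ρ.toLocal v) := by
  intro K _ _ RD hcpt π hL ℓ _ ι ρ hae v hv
  obtain ⟨-, hgeo, hcorr⟩ := core_of_langlands hS K RD hcpt π hL ℓ ι ρ hae
  exact ⟨hcorr.2 v, hgeo.2 v hv⟩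

/-- **S → C**: the summit `Langlands` implies the crux `AlignedAtEll`. [folklore] -/
theorem alignedAtEll_of_langlands (hS : _root_.Langlands) :
    Summit.Langlands.Langlands.Theses.SenNullAlignment.AlignedAtEll := by
  intro K _ _ _hK RD _hreg hcpt π _k _w hL _hhol _hodd _hne ℓ _ ι ρ _hirr hae v hv _hal _hfin
  exact alignedAtEll_core_of_langlands hS K RD hcpt π hL ℓ ι ρ hae v hv

/-- The same from the summit's direction (A) ALONE for rank `2` over totally real fields (no direction
(B), no other rank). [folklore] -/
theorem alignedAtEll_of_automorphicToGalois
    (hA : ∀ (K : Type) [Field K] [NumberField K], NumberField.IsTotallyReal K →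
      ∀ (RD : ReciprocityData K) (hcpt : isCompact_glFiniteIntegralLevel 2 K),
        AutomorphicToGalois 2 RD hcpt) :
    Summit.Langlands.Langlands.Theses.SenNullAlignment.AlignedAtEll := by
  intro K _ _ hK RD _hreg hcpt π _k _w hL _hhol _hodd _hne ℓ _ ι ρ hirr hae v hv _hal _hfin
  obtain ⟨ρ₁, hirr₁, hgeo₁, hcorr₁, -⟩ := hA K hK RD hcpt π hL ℓ ι
  have hcorr : Corresponds RD ι π.1 ρ := corresponds_of_exists_corresponds hirr hae ⟨ρ₁, hcorr₁⟩
  have hconj : IsConjugate ρ₁ ρ := isConjugate_of_satakeFrobCompatibleAt π.1 ι hirr₁ hcorr₁.1 hae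
  exact ⟨hcorr.2 v, (isGeometricFramed_of_isConjugate hgeo₁ hconj).2 v hv⟩

end Summit.Langlands.Langlands.Cruxes.AlignedAtEll.RefuterProbe
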